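import Summits.QuantumFields.YangMills.Theorems.TwistedTraceScaling.Negative.AvgKernelNoLabSlowFactor
import HarnessLib

/-!
# R32b — no LAB one-site slow factor for `K̃_β` EVEN ON THE KINETIC CORE: the flip pair at LAB distance `C·(L³β)^{−1/2}` (crux `TwistedTraceScaling`,
# stmt-QuantumFields-20203; lane A's C4-CORE design COARSE-DESIGN §23.2 (3) / §23.7, «(3)/(d) claimed on the kinetic core with tails», `η_K = O(β^{−s}·δ_g β^{1/2}) → 0`)

R32 (`…Negative.AvgKernelNoLabSlowFactor`) kills the LAB one-site factor `K₁^{L³β}(u,u') = K_β(constLift u, constLift u')` of the displayed pointwise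
factorisation `K̃_β = 𝒩·K₁^{L³β}(u,u')·G_st·(1 ± η_K)` with a FIXED `η < 1` by a flip pair at LAB distance `≍ β^{−s}` — in the «tails» of the display.  THIS FILE closes
the remaining reading «(3) holds on the kinetic core `|u − u'| ≲ (L³β)^{−1/2}` with `η_K → 0`»: the SAME diagonal Weyl flip `u_θ = (diagSU2 θ)³ ↦ u_{−θ} = Ad_W u_θ`, now
with the KINETIC angle `θ = C/(4√(L³β))`, gives a pair of constant one-site data inside the core (`‖u_k − 1‖_F < β^{−s}`, `orbitDist < β^{−s}`, eventually in `β`, any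
`0 ≤ s < 1/2`) at LAB distance `‖u_k − u'_k‖_F ≤ C·(L³β)^{−1/2}` on which `K̃_β` takes its DIAGONAL value (`R32.avgKernel_constDiag_flip`) while the LAB kernel pays the
fixed factor `K_β(constLift u_θ, constLift u_{−θ}) ≤ e^{−C²/(16L³)}·K_β(constLift u_θ, constLift u_θ)` (`R32.transferKernel_constDiag_flip`, `βθ² = C²/(16L³)`).
* ★★ `exists_kinetic_flip_pair`: the pair, for every `C > 0`.
* ★★ `not_lab_oneSite_sandwich_kinetic` / `…_const`: for `0 ≤ s < 1/2` and every `C > 0` there are NO `η_β → 0`, eventual `𝒩_β > 0` and positive `Ad`-invariant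
  one-body factors `a_β` with `(1−η_β)·𝒩_β a_β(u)a_β(u')·K_β ≤ K̃_β ≤ (1+η_β)·𝒩_β a_β(u)a_β(u')·K_β` on the pairs of the core at LAB distance `≤ C·(L³β)^{−1/2}`.
READING (as R32): `K̃_β(constLift u, constLift u')` is flat along the `Ad`-orbit directions of the slow pair even inside the kinetic core (3 of the 9 slow
dimensions); its slow factor is the `Ad`-AVERAGED one-site kernel `∫K₁^{L³β}(u, Ad_g u')dg`, Gaussian only transversally to the orbit; the slow min–max runs over
`Ad`-invariant one-site functions, on which `K₁` and its average coincide as operators — the repair is cheap, the display is misstated.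
HONEST FRAMING: finite-dimensional identities/inequalities about one displayed intermediate formula of lane A's design for a stub (C4) of a child of the CONDITIONAL
reduction route R2b1 (`LuscherReduction`); it does not refute `TwistedTraceScaling`, C4, or any registered statement; not a gap, not Clay.

## References
* M. Lüscher, Some analytic results concerning the mass spectrum of Yang–Mills gauge theories on a torus, Nucl. Phys. B219 (1983) 233–261, §3. [Luscher1983]
* E. Seiler, Gauge Theories as a Problem of Constructive Quantum Field Theory and Statistical Mechanics, LNP 159 (1982), §3. [SeilerLNP1982]
-/

set_option autoImplicit false

noncomputable section

open Real Filter Topology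
open Literature.MathematicalPhysics.QuantumFieldTheory hiding SU2
open Literature.MathematicalPhysics.QuantumLattice

namespace Summit.QuantumFields.YangMills.Theorems.TwistedTraceScaling.Negative.R32b

open Summit.QuantumFields.YangMills.Theorems.FemtoTransferGap
open Summit.QuantumFields.YangMills.Theorems.FemtoTransferGap.TwoLattice.Toron (frobNorm_diagSU2_sub_one_le)
open Summit.QuantumFields.YangMills.Theorems.FemtoTransferGap.TwoLattice.Avg
open Summit.QuantumFields.YangMills.Theorems.TwistedTraceScaling.Negative.R32

variable {L : ℕ} [NeZero L]

/-- The LAB distance of the flip: `‖diagSU2 θ − diagSU2 (−θ)‖_F ≤ 2√2·|θ|`. [folklore] -/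
theorem frobNorm_diagSU2_sub_diagSU2_neg_le (θ : ℝ) :
    frobNorm (((diagSU2 θ : SU2) : Matrix (Fin 2) (Fin 2) ℂ) - ((diagSU2 (-θ) : SU2) : Matrix (Fin 2) (Fin 2) ℂ)) ≤ 2 * Real.sqrt 2 * |θ| := by
  have h1 := frobNorm_diagSU2_sub_one_le θ
  have h2 := frobNorm_diagSU2_sub_one_le (-θ)
  rw [abs_neg] at h2
  have h := frobNorm_sub_le (((diagSU2 θ : SU2) : Matrix (Fin 2) (Fin 2) ℂ)) 1 (((diagSU2 (-θ) : SU2) : Matrix (Fin 2) (Fin 2) ℂ))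
  rw [frobNorm_sub_comm (1 : Matrix (Fin 2) (Fin 2) ℂ)] at h
  linarith

/-- ★★ **The kinetic flip pair.**  For `0 ≤ s < 1/2` and `C > 0`, eventually in `β`: constant one-site data `u = (diagSU2 θ)³`, `u' = (diagSU2 (−θ))³ = Ad_W u`,
`θ = C/(4√(L³β))`, both in the core, at LAB distance `‖u_k − u'_k‖_F ≤ C/√(L³β)`, with `K̃_β(constLift u, constLift u') = K̃_β(constLift u, constLift u)` and
`K_β(constLift u, constLift u') ≤ e^{−C²/(16L³)}·K_β(constLift u, constLift u)`. [folklore] -/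
theorem exists_kinetic_flip_pair {s C : ℝ} (hs0 : 0 ≤ s) (hs : s < 1 / 2) (hC : 0 < C) :
    ∃ β₀ : ℝ, ∀ β : ℝ, β₀ ≤ β → ∃ u u' : GaugeConfig 3 1 SU2,
      (∀ e, frobNorm (((u e : SU2) : Matrix (Fin 2) (Fin 2) ℂ) - 1) < powScale s β) ∧
      (∀ e, frobNorm (((u' e : SU2) : Matrix (Fin 2) (Fin 2) ℂ) - 1) < powScale s β) ∧
      orbitDist (constLift L u) < powScale s β ∧ orbitDist (constLift L u') < powScale s β ∧
      (∀ e, frobNorm (((u e : SU2) : Matrix (Fin 2) (Fin 2) ℂ) - ((u' e : SU2) : Matrix (Fin 2) (Fin 2) ℂ)) ≤ C / Real.sqrt ((L : ℝ) ^ 3 * β)) ∧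
      (∃ g : SU2, u' = gaugeTransform (fun _ : Site 3 1 => g) u) ∧
      avgKernel β (constLift L u) (constLift L u') = avgKernel β (constLift L u) (constLift L u) ∧
      transferKernel su2Rep β (constLift L u) (constLift L u') ≤
        Real.exp (-(C ^ 2 / (16 * (L : ℝ) ^ 3))) * transferKernel su2Rep β (constLift L u) (constLift L u) := by
  obtain ⟨W, hW⟩ := exists_weylFlip
  have hq : 0 < 1 - 2 * s := by linarith
  have hL1 : (1 : ℝ) ≤ (L : ℝ) := by exact_mod_cast Nat.one_le_iff_ne_zero.mpr (NeZero.ne L)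
  have hL3 : (1 : ℝ) ≤ (L : ℝ) ^ 3 := one_le_pow₀ hL1
  -- the threshold: `β^{1−2s} ≥ 4 C² L³`, i.e. the kinetic angle is below R32's core angle `β^{−s}/(8L³)`
  set T : ℝ := 4 * C ^ 2 * (L : ℝ) ^ 3 with hT
  have hT0 : 0 < T := by positivity
  obtain ⟨β₀, hβ₀⟩ := rpow_neg_eventually_le hq (inv_pos.mpr hT0)
  refine ⟨β₀, fun β hβ => ?_⟩
  obtain ⟨hβ1, hβT⟩ := hβ₀ β hβ
  have hβ0 : 0 < β := by linarith
  have hδ : powScale s β = β ^ (-s) := powScale_eq hβ1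
  have hδ0 : 0 < powScale s β := powScale_pos s β
  have hLβ : 0 < (L : ℝ) ^ 3 * β := by positivity
  have hsq : Real.sqrt ((L : ℝ) ^ 3 * β) ^ 2 = (L : ℝ) ^ 3 * β := Real.sq_sqrt hLβ.le
  have hsq0 : 0 < Real.sqrt ((L : ℝ) ^ 3 * β) := Real.sqrt_pos.mpr hLβ
  -- the kinetic angle
  set θ : ℝ := C / (4 * Real.sqrt ((L : ℝ) ^ 3 * β)) with hθ
  have hθ0 : 0 < θ := by positivity
  have hβθ : β * θ ^ 2 = C ^ 2 / (16 * (L : ℝ) ^ 3) := by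
    rw [hθ, div_pow, mul_pow, hsq]
    field_simp
    ring
  -- `θ ≤ β^{−s}/(8L³)` (squares compared: `C²/(16L³β) ≤ β^{−2s}/(64L⁶)` iff `4C²L³ ≤ β^{1−2s}`)
  have hpow : T ≤ β ^ (1 - 2 * s) := by
    have h := hβT
    rw [Real.rpow_neg hβ0.le] at h
    rwa [inv_le_inv₀ (Real.rpow_pos_of_pos hβ0 _) hT0] at h
  have hθle8 : θ ≤ powScale s β / (8 * (L : ℝ) ^ 3) := by
    have h0 : 0 ≤ powScale s β / (8 * (L : ℝ) ^ 3) := by positivity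
    rw [← pow_le_pow_iff_left₀ hθ0.le h0 two_ne_zero]
    have h1 : θ ^ 2 = C ^ 2 / (16 * (L : ℝ) ^ 3) / β := by
      rw [← hβθ]; field_simp
    have h2 : (powScale s β / (8 * (L : ℝ) ^ 3)) ^ 2 = β ^ (1 - 2 * s) / (64 * ((L : ℝ) ^ 3) ^ 2) / β := by
      rw [hδ, div_pow, mul_pow, ← Real.rpow_natCast (β ^ (-s)) 2, ← Real.rpow_mul hβ0.le,
        show (1 : ℝ) - 2 * s = 1 + -s * ((2 : ℕ) : ℝ) by push_cast; ring, Real.rpow_add hβ0, Real.rpow_one]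
      field_simp
      ring
    rw [h1, h2]
    refine div_le_div_of_nonneg_right ?_ hβ0.le
    rw [div_le_div_iff₀ (by positivity) (by positivity)]
    have : C ^ 2 * (64 * ((L : ℝ) ^ 3) ^ 2) = T * (16 * (L : ℝ) ^ 3) := by rw [hT]; ring
    rw [this]
    exact mul_le_mul_of_nonneg_right hpow (by positivity)
  have hθle : θ ≤ powScale s β / 8 := hθle8.trans (div_le_div_of_nonneg_left hδ0.le (by norm_num) (by nlinarith))
  have hs2 : Real.sqrt 2 < 2 := (Real.sqrt_lt' (by norm_num)).mpr (by norm_num)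
  have hs2θ : Real.sqrt 2 * θ < 2 * θ := mul_lt_mul_of_pos_right hs2 hθ0
  have hδ1 : powScale s β ≤ 1 := by rw [hδ]; exact Real.rpow_le_one_of_one_le_of_nonpos hβ1 (by linarith)
  have hθ1 : θ ≤ π / 2 := by linarith [Real.pi_gt_three]
  refine ⟨fun _ => diagSU2 θ, fun _ => diagSU2 (-θ), fun _ => ?_, fun _ => ?_, ?_, ?_, fun _ => ?_, ⟨W, oneSite_diag_neg_eq_gaugeTransform hW θ⟩,
    avgKernel_constDiag_flip β θ, ?_⟩
  · refine (frobNorm_diagSU2_sub_one_le θ).trans_lt ?_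
    rw [abs_of_pos hθ0]
    linarith
  · refine (frobNorm_diagSU2_sub_one_le (-θ)).trans_lt ?_
    rw [abs_neg, abs_of_pos hθ0]
    linarith
  · refine (orbitDist_constDiag_le θ).trans_lt ?_
    rw [abs_of_pos hθ0]
    have h1 : 3 * Real.sqrt 2 * (L : ℝ) ^ 3 * θ ≤ 3 * Real.sqrt 2 * (L : ℝ) ^ 3 * (powScale s β / (8 * (L : ℝ) ^ 3)) :=
      mul_le_mul_of_nonneg_left hθle8 (by positivity)
    have h2 : 3 * Real.sqrt 2 * (L : ℝ) ^ 3 * (powScale s β / (8 * (L : ℝ) ^ 3)) = 3 * Real.sqrt 2 / 8 * powScale s β := by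
      field_simp
    nlinarith
  · refine (orbitDist_constDiag_le (-θ)).trans_lt ?_
    rw [abs_neg, abs_of_pos hθ0]
    have h1 : 3 * Real.sqrt 2 * (L : ℝ) ^ 3 * θ ≤ 3 * Real.sqrt 2 * (L : ℝ) ^ 3 * (powScale s β / (8 * (L : ℝ) ^ 3)) :=
      mul_le_mul_of_nonneg_left hθle8 (by positivity)
    have h2 : 3 * Real.sqrt 2 * (L : ℝ) ^ 3 * (powScale s β / (8 * (L : ℝ) ^ 3)) = 3 * Real.sqrt 2 / 8 * powScale s β := by
      field_simp
    nlinarith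
  · -- LAB distance `≤ 2√2 θ ≤ 4θ = C/√(L³β)`
    refine (frobNorm_diagSU2_sub_diagSU2_neg_le θ).trans ?_
    rw [abs_of_pos hθ0]
    have h4 : 4 * θ = C / Real.sqrt ((L : ℝ) ^ 3 * β) := by rw [hθ]; field_simp
    nlinarith
  · rw [transferKernel_constDiag_flip]
    refine mul_le_mul_of_nonneg_right ?_ (transferKernel_pos su2Rep β _ _).le
    rw [Real.exp_le_exp, neg_le_neg_iff, ← hβθ]
    have hcard : (1 : ℝ) ≤ Fintype.card (Edge 3 L) := by exact_mod_cast Fintype.card_pos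
    have hkin : θ ^ 2 ≤ 2 - 2 * Real.cos (2 * θ) := sq_le_two_sub_two_cos_two_mul hθ0.le hθ1
    have hk0 : 0 ≤ β * (2 - 2 * Real.cos (2 * θ)) := mul_nonneg hβ0.le ((sq_nonneg θ).trans hkin)
    calc β * θ ^ 2 ≤ β * (2 - 2 * Real.cos (2 * θ)) := mul_le_mul_of_nonneg_left hkin hβ0.le
      _ = β * (2 - 2 * Real.cos (2 * θ)) * 1 := (mul_one _).symm
      _ ≤ β * (2 - 2 * Real.cos (2 * θ)) * Fintype.card (Edge 3 L) := mul_le_mul_of_nonneg_left hcard hk0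

/-- ★★ **NO LAB one-site slow factor on the kinetic core either.**  For `0 ≤ s < 1/2` and every `C > 0` there are NO `η_β → 0`, eventual `𝒩_β > 0` and positive
`Ad`-invariant one-body factors `a_β` such that `(1−η_β)·𝒩_β a_β(u)a_β(u')·K_β(constLift u, constLift u') ≤ K̃_β(constLift u, constLift u') ≤ (1+η_β)·(same)` for all
one-site `u, u'` in the core (`‖u_k − 1‖_F, ‖u'_k − 1‖_F < β^{−s}`, `orbitDist < β^{−s}`) at LAB distance `‖u_k − u'_k‖_F ≤ C/√(L³β)`.  Proof: at the kinetic flip pair the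
middle terms agree while the LAB kernels differ by the fixed factor `e^{−C²/(16L³)} < (1−η_β)/(1+η_β) → 1`. [folklore] -/
theorem not_lab_oneSite_sandwich_kinetic {s C : ℝ} (hs0 : 0 ≤ s) (hs : s < 1 / 2) (hC : 0 < C)
    {a : ℝ → GaugeConfig 3 1 SU2 → ℝ} (ha0 : ∀ β u, 0 < a β u)
    (ha : ∀ (β : ℝ) (g : SU2) (u : GaugeConfig 3 1 SU2), a β (gaugeTransform (fun _ : Site 3 1 => g) u) = a β u) :
    ¬ ∃ η : ℝ → ℝ, Tendsto η atTop (𝓝 0) ∧ ∃ β₀ : ℝ, ∀ β : ℝ, β₀ ≤ β → ∃ 𝒩 : ℝ, 0 < 𝒩 ∧ ∀ u u' : GaugeConfig 3 1 SU2,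
        (∀ e, frobNorm (((u e : SU2) : Matrix (Fin 2) (Fin 2) ℂ) - 1) < powScale s β) →
        (∀ e, frobNorm (((u' e : SU2) : Matrix (Fin 2) (Fin 2) ℂ) - 1) < powScale s β) →
        orbitDist (constLift L u) < powScale s β → orbitDist (constLift L u') < powScale s β →
        (∀ e, frobNorm (((u e : SU2) : Matrix (Fin 2) (Fin 2) ℂ) - ((u' e : SU2) : Matrix (Fin 2) (Fin 2) ℂ)) ≤ C / Real.sqrt ((L : ℝ) ^ 3 * β)) →
        (1 - η β) * (𝒩 * (a β u * a β u')) * transferKernel su2Rep β (constLift L u) (constLift L u') ≤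
            avgKernel β (constLift L u) (constLift L u') ∧
        avgKernel β (constLift L u) (constLift L u') ≤
            (1 + η β) * (𝒩 * (a β u * a β u')) * transferKernel su2Rep β (constLift L u) (constLift L u') := by
  rintro ⟨η, hη, β₀, hβ₀⟩
  -- the fixed LAB loss `E = e^{−C²/(16L³)} < 1` and the tolerance `η₁ = (1 − E)/4`
  set E : ℝ := Real.exp (-(C ^ 2 / (16 * (L : ℝ) ^ 3))) with hE
  have hE0 : 0 < E := Real.exp_pos _
  have hL0 : (0 : ℝ) < (L : ℝ) := by exact_mod_cast Nat.pos_of_ne_zero (NeZero.ne L)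
  have hE1 : E < 1 := Real.exp_lt_one_iff.mpr (by have : 0 < C ^ 2 / (16 * (L : ℝ) ^ 3) := (by positivity); linarith)
  set η₁ : ℝ := (1 - E) / 4 with hη₁
  have hη₁0 : 0 < η₁ := by rw [hη₁]; linarith
  obtain ⟨β₂, hβ₂⟩ := (Metric.tendsto_atTop.mp hη) η₁ hη₁0
  obtain ⟨β₁, hβ₁⟩ := exists_kinetic_flip_pair (L := L) hs0 hs hC
  set β := max β₀ (max β₁ β₂) with hβdef
  obtain ⟨𝒩, h𝒩, h⟩ := hβ₀ β (le_max_left _ _)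
  obtain ⟨u, u', hu, hu', ho, ho', hd, ⟨g, hg⟩, hA, hK⟩ := hβ₁ β ((le_max_left _ _).trans (le_max_right _ _))
  have hηβ : |η β| < η₁ := by
    have := hβ₂ β ((le_max_right _ _).trans (le_max_right _ _))
    rwa [Real.dist_eq, sub_zero] at this
  have ha' : a β u' = a β u := by rw [hg, ha]
  have hd0 : ∀ e, frobNorm (((u e : SU2) : Matrix (Fin 2) (Fin 2) ℂ) - ((u e : SU2) : Matrix (Fin 2) (Fin 2) ℂ)) ≤ C / Real.sqrt ((L : ℝ) ^ 3 * β) :=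
    fun e => by rw [sub_self, frobNorm_zero]; exact div_nonneg hC.le (Real.sqrt_nonneg _)
  have hlow := (h u u hu hu ho ho hd0).1
  have hup := (h u u' hu hu' ho ho' hd).2
  rw [ha', hA] at hup
  have hP : 0 < 𝒩 * (a β u * a β u) := by have := ha0 β u; positivity
  have hKpos := transferKernel_pos su2Rep β (constLift L u) (constLift L u)
  have hηle := (abs_lt.mp hηβ)
  -- `(1−η)·P·K ≤ Ã ≤ (1+η)·P·K' ≤ (1+η)·P·E·K`, so `1 − η ≤ (1 + η)E`; impossible for `|η| < (1−E)/4`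
  have h1 : (1 + η β) * (𝒩 * (a β u * a β u)) * transferKernel su2Rep β (constLift L u) (constLift L u') ≤
      (1 + η β) * (𝒩 * (a β u * a β u)) * (E * transferKernel su2Rep β (constLift L u) (constLift L u)) :=
    mul_le_mul_of_nonneg_left hK (mul_nonneg (by linarith) hP.le)
  have h2 : (1 - η β) * (𝒩 * (a β u * a β u) * transferKernel su2Rep β (constLift L u) (constLift L u)) ≤
      (1 + η β) * E * (𝒩 * (a β u * a β u) * transferKernel su2Rep β (constLift L u) (constLift L u)) := by
    have := hlow.trans (hup.trans h1)
    nlinarith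
  have h3 : 1 - η β ≤ (1 + η β) * E := le_of_mul_le_mul_right h2 (mul_pos hP hKpos)
  have h4 : (1 + η β) * E ≤ (1 + η₁) * E := mul_le_mul_of_nonneg_right (by linarith) hE0.le
  nlinarith

/-- ★★ **The display (3) on the kinetic core, verbatim** (`a ≡ 1`): for `0 ≤ s < 1/2` and every `C > 0`, no `η_β → 0` and eventual `𝒩_β > 0` with
`(1−η_β)𝒩_β·K_β ≤ K̃_β ≤ (1+η_β)𝒩_β·K_β` on the pairs of constant one-site data in the core at LAB distance `≤ C/√(L³β)`. [folklore] -/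
theorem not_lab_oneSite_sandwich_kinetic_const {s C : ℝ} (hs0 : 0 ≤ s) (hs : s < 1 / 2) (hC : 0 < C) :
    ¬ ∃ η : ℝ → ℝ, Tendsto η atTop (𝓝 0) ∧ ∃ β₀ : ℝ, ∀ β : ℝ, β₀ ≤ β → ∃ 𝒩 : ℝ, 0 < 𝒩 ∧ ∀ u u' : GaugeConfig 3 1 SU2,
        (∀ e, frobNorm (((u e : SU2) : Matrix (Fin 2) (Fin 2) ℂ) - 1) < powScale s β) →
        (∀ e, frobNorm (((u' e : SU2) : Matrix (Fin 2) (Fin 2) ℂ) - 1) < powScale s β) →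
        orbitDist (constLift L u) < powScale s β → orbitDist (constLift L u') < powScale s β →
        (∀ e, frobNorm (((u e : SU2) : Matrix (Fin 2) (Fin 2) ℂ) - ((u' e : SU2) : Matrix (Fin 2) (Fin 2) ℂ)) ≤ C / Real.sqrt ((L : ℝ) ^ 3 * β)) →
        (1 - η β) * 𝒩 * transferKernel su2Rep β (constLift L u) (constLift L u') ≤ avgKernel β (constLift L u) (constLift L u') ∧
        avgKernel β (constLift L u) (constLift L u') ≤ (1 + η β) * 𝒩 * transferKernel su2Rep β (constLift L u) (constLift L u') := by
  rintro ⟨η, hη, β₀, hβ₀⟩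
  refine not_lab_oneSite_sandwich_kinetic (L := L) hs0 hs hC (a := fun _ _ => (1 : ℝ)) (fun _ _ => one_pos) (fun _ _ _ => rfl)
    ⟨η, hη, β₀, fun β hβ => ?_⟩
  obtain ⟨𝒩, h𝒩, h⟩ := hβ₀ β hβ
  refine ⟨𝒩, h𝒩, fun u u' hu hu' ho ho' hd => ?_⟩
  simpa only [mul_one] using h u u' hu hu' ho ho' hd

end Summit.QuantumFields.YangMills.Theorems.TwistedTraceScaling.Negative.R32b

end
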